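import Summits.HubbardSuperconductivity.HubbardSuperconductivity.Theorems.AnisotropyChordTransferFibre3ZSquareWindow

/-!
# Route `AnisotropyChord` / H0 rotor rung: the ℤ² kernel window `|x|, |y| ≤ 5` as a COMPUTABLE table in `ℚ × ℚ` (rational part, coefficient of `1/π`)

Packaging of p1 g25's closed forms (`…Fibre3DiagonalValues`, `…Fibre3ZSquareWindow`: `aZ2 x y` for `0 ≤ y ≤ x ≤ 5` in `ℚ + ℚ/π`)
as one computable function, for use by kernel-evaluated (`decide`) certificates of the near-pair HOLE₂ skeletons
(`…Fibre3TwoHoleBSCertCheck`):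
* `aZ2Q : ℕ → ℕ → ℚ × ℚ` (the 21 canonical values; `(0,0)` off the table), `aZ2Qz : ℤ → ℤ → ℚ × ℚ` (all signs and orders);
* `aZ2_natAbs` (`a_∞(x,y) = a_∞(|x|,|y|)`), `aZ2_table` (canonical window), ★ `aZ2_eq_aZ2Qz`:
  `aZ2 x y = (aZ2Qz x y).1 + (aZ2Qz x y).2/π` for all `|x|, |y| ≤ 5`.
Prover seat `hubbard-h0-rotor-p2` g3; helper for stmt-HubbardSuperconductivity-19089 (`--supports`, helper class).
WHAT THIS IS NOT: nothing here proves superconductivity in the Hubbard model; the rotor TARGET as originally worded stays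
FALSE (g15 verdict).  Bookkeeping of classical lattice Green's function values for ONE input (HOLE₂ skeletons) of ONE conditional
reduction (rung 19089).  Mathlib + tree imports only; no sorry, no axioms.
-/

set_option linter.dupNamespace false
set_option autoImplicit false

noncomputable section

namespace Summit.HubbardSuperconductivity.HubbardSuperconductivity.Theorems.AnisotropyChord.Transfer.Fibre3

namespace Subsample

/-- the canonical window table of `a_∞` (KT units) as `(rational part, coefficient of 1/π)`, `0 ≤ y ≤ x ≤ 5`. [folklore] -/
def aZ2Q : ℕ → ℕ → ℚ × ℚ
  | 0, 0 => (0, 0)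
  | 1, 0 => (1/4, 0)
  | 1, 1 => (0, 1)
  | 2, 0 => (1, -2)
  | 2, 1 => (-1/4, 2)
  | 2, 2 => (0, 4/3)
  | 3, 0 => (17/4, -12)
  | 3, 1 => (-2, 23/3)
  | 3, 2 => (1/4, 2/3)
  | 3, 3 => (0, 23/15)
  | 4, 0 => (20, -184/3)
  | 4, 1 => (-49/4, 40)
  | 4, 2 => (3, -118/15)
  | 4, 3 => (-1/4, 12/5)
  | 4, 4 => (0, 176/105)
  | 5, 0 => (401/4, -940/3)
  | 5, 1 => (-70, 3323/15)
  | 5, 2 => (97/4, -1118/15)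
  | 5, 3 => (-4, 499/35)
  | 5, 4 => (1/4, 20/21)
  | 5, 5 => (0, 563/315)
  | _, _ => (0, 0)

/-- the table at arbitrary signs and order (`a_∞` is `D₄`-invariant). [folklore] -/
def aZ2Qz (x y : ℤ) : ℚ × ℚ :=
  if y.natAbs ≤ x.natAbs then aZ2Q x.natAbs y.natAbs else aZ2Q y.natAbs x.natAbs

/-- `a_∞(x, y) = a_∞(|x|, |y|)`. [folklore] -/
theorem aZ2_natAbs (x y : ℤ) : aZ2 x y = aZ2 (x.natAbs : ℤ) (y.natAbs : ℤ) := by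
  rcases Int.natAbs_eq x with hx | hx <;> rcases Int.natAbs_eq y with hy | hy
  · rw [← hx, ← hy]
  · conv_lhs => rw [hx, hy]
    rw [aZ2_mirror_y]
  · conv_lhs => rw [hx, hy]
    rw [aZ2_mirror]
  · conv_lhs => rw [hx, hy]
    rw [aZ2_neg]

/-- the canonical window in closed form. [folklore] -/
theorem aZ2_table (x y : ℕ) (hyx : y ≤ x) (hx : x ≤ 5) :
    aZ2 x y = ((aZ2Q x y).1 : ℝ) + ((aZ2Q x y).2 : ℝ) / Real.pi := by
  have hpi : Real.pi ≠ 0 := Real.pi_ne_zero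
  interval_cases x <;> interval_cases y <;>
    simp only [aZ2Q, Nat.cast_ofNat, Nat.cast_zero, Nat.cast_one, Rat.cast_zero, Rat.cast_one, Rat.cast_ofNat,
      Rat.cast_neg, Rat.cast_div, zero_div, add_zero, zero_add, aZ2_zero, aZ2_one_zero, aZ2_one_one,
      aZ2_two_zero', aZ2_two_one', aZ2_two_two, aZ2_three_zero', aZ2_three_one', aZ2_three_two', aZ2_three_three,
      aZ2_four_zero, aZ2_four_one, aZ2_four_two, aZ2_four_three, aZ2_four_four, aZ2_five_zero, aZ2_five_one,
      aZ2_five_two, aZ2_five_three, aZ2_five_four, aZ2_five_five] <;>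
    field_simp <;> ring

/-- ★ the ℤ² kernel on the whole window `|x|, |y| ≤ 5` from the table. [folklore] -/
theorem aZ2_eq_aZ2Qz (x y : ℤ) (hx : x.natAbs ≤ 5) (hy : y.natAbs ≤ 5) :
    aZ2 x y = ((aZ2Qz x y).1 : ℝ) + ((aZ2Qz x y).2 : ℝ) / Real.pi := by
  rw [aZ2_natAbs]
  unfold aZ2Qz
  by_cases h : y.natAbs ≤ x.natAbs
  · rw [if_pos h]
    exact aZ2_table x.natAbs y.natAbs h hx
  · rw [if_neg h, ← aZ2_swap]
    exact aZ2_table y.natAbs x.natAbs (by omega) hy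

end Subsample

end Summit.HubbardSuperconductivity.HubbardSuperconductivity.Theorems.AnisotropyChord.Transfer.Fibre3

end
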